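import Literature.Analysis.SpecialFunctions.BetaIntegralPanel
import Mathlib.Analysis.SpecialFunctions.Pow.Real
import HarnessLib

/-!
# (E-a) Tier 2 — the analytic identity behind the S₈ panel model (piece (B1))

LINE 1 — FRAMING: RH-FREE elementary calculus (Euler Beta integrals at natural arguments and finite
sums); cell rh-crit, corpus C1, seat t4 g4; Tier-2 soundness support for the (E-a) kernel
certificate of `CC2021_section6_enclosures` (cc-lead R127: piece (B1) «analytic identity»; consumer:
cc-iso g4's (T2b-sound) read-back of the landed data module `ArchKernelTier2Panels.lean`, p447146).
bears_on: W-C/W-P (K3 `WindowSpectralBound`, stmt-RiemannHypothesis-19306).  WHAT THIS IS NOT: a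
certificate, an enclosure, a statement about prolate functions, or any claim about RH — nothing here
bears on the truth of RH.

## What is proved (theorems only: 0 definitions, 0 named facts)

Write `u = 1 − ρ⁻¹`, `σ = ρ − 1` (so `ρu = σ`, `1 − ρ = −σ`) and `β(i,j) = i! j!/(i+j+1)!`.

* `integral_one_sub_pow_mul_one_sub_mul_pow` — for `ρ ≠ 0`,
  `∫_{ρ⁻¹}^{1} (1−x)^i (1−ρx)^j dx = u^{i+1} · (1−ρ)^j · β(i,j)`
  (substitution `x = 1 − w`, `1 − ρ(1−w) = −ρ(u − w)`, the tree's `integral_pow_mul_sub_pow`);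
* `integral_sum_mul_sum_eq` — the same against two finite coefficient families (a polynomial in
  `1 − x` of length `Kin` times a polynomial in `1 − ρx` of length `Kout`):
  `∫_{ρ⁻¹}^{1} (Σ_{i<Kin} g_i (1−x)^i)(Σ_{j<Kout} f_j (1−ρx)^j) dx = u · Σ_{i<Kin} (Σ_{j<Kout} g_i f_j β(i,j) (1−ρ)^j) · u^i`;
* `sum_trunc_eq_model` — summing `N` such «modes» with weights `t_n`, inner families `g_n`, `f_n`
  (length `Kin`) and outer families `f_n` (length `Kout`):
  `Σ_{n<N} t_n·(ρ^{3/2}(∫_{ρ⁻¹}^1 G_n(x)F_n(ρx)dx + F_n(ρ)) − ρ^{−3/2} Fi_n(ρ⁻¹))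
     = ρ^{3/2}·(u·Σ_{i<Kin}(Σ_{j<Kout} C_{ij}(1−ρ)^j)u^i + Σ_{j<Kout} cFs_j (1−ρ)^j) − ρ^{−3/2}·Σ_{i<Kin} cFu_i u^i`
  with `C_{ij} = Σ_n t_n g_{n,i} f_{n,j} β(i,j)`, `cFs_j = Σ_n t_n f_{n,j}`, `cFu_i = Σ_n t_n f_{n,i}` —
  this right-hand side is, symbol for symbol, the polynomial that the landed Taylor model
  `ArchCertT2.s8TM` encloses (`R32·(U·Jcore + Fs) − Rm32·Fu` with `U = 1 − e^{−v}`, `NS = 1 − e^{v}`),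
  and the left-hand side is the mode sum of CC2021's eq. (99) bracket with the Frobenius series
  replaced by their truncations (t7's `sonineQTerm_prolateFun_eq_frob`: `τ(n)T_n(ρ) =
  t_n·(ρ^{1/2}∫(xu′)(ρxu′(ρx)) + ρ^{−3/2}u′(ρ⁻¹) − ρ^{3/2}u′(ρ))`, `u′ ≈ −F`, `x²u′ ≈ −G`);
* `sum_trunc_exp_eq_model` — the same in the additive panel variable `ρ = e^{v}`
  (`ρ^{3/2} = e^{(3/2)v}`, `ρ^{−3/2} = e^{−(3/2)v}`, `ρ⁻¹ = e^{−v}`).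

The families `t, g, f` are ARBITRARY reals here: the identity is pure algebra plus the Beta integral;
which reals they are (enclosed by the K1 data) and how far the truncations are from the prolate
quantities (the allowance `W`) are the other two pieces of the read-back ((B2), cc-iso's estimate).

References: Euler's Beta integral at natural arguments [cite: Jeffrey1995, §11.1.7.1 (p0143:L67–L76)]
via the tree (`Literature.Analysis.SpecialFunctions.integral_pow_mul_sub_pow`, seat t12 g2); the
bracket being modelled is CC2021 §5 eq. (99) p. 32 / §6.3–6.4 p. 24 [cite: ConnesConsani2021, §5 eq. (99) p. 32; §6.3 p. 24].
-/

noncomputable section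

open Real MeasureTheory Set intervalIntegral Finset
open scoped Nat

namespace Literature.NumberTheory.ConnesConsani2021

namespace S8Identity

open Literature.Analysis.SpecialFunctions

/-! ## One monomial pair -/

/-- **`∫_{ρ⁻¹}^{1} (1−x)^i (1−ρx)^j dx = (1−ρ⁻¹)^{i+1} (1−ρ)^j β(i,j)`** for `ρ ≠ 0`
(`x = 1 − w`, `1 − ρ(1 − w) = −ρ(u − w)` with `u = 1 − ρ⁻¹`, Euler's Beta integral, and
`(−ρ)^j u^j = (1 − ρ)^j` from `ρu = ρ − 1`).
[cite: Jeffrey1995, §11.1.7.1 (Beta function) (p0143:L67–L76); ConnesConsani2021, §6.3 p. 24 (the kernel whose panel model this serves)] -/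
theorem integral_one_sub_pow_mul_one_sub_mul_pow {ρ : ℝ} (hρ : ρ ≠ 0) (i j : ℕ) :
    ∫ x in ρ⁻¹..(1 : ℝ), (1 - x) ^ i * (1 - ρ * x) ^ j =
      (1 - ρ⁻¹) ^ (i + 1) * (1 - ρ) ^ j * ((i ! * j ! : ℝ) / (i + j + 1)!) := by
  set u : ℝ := 1 - ρ⁻¹ with hu
  have hsub := intervalIntegral.integral_comp_sub_left
    (fun x : ℝ ↦ (1 - x) ^ i * (1 - ρ * x) ^ j) (a := (0 : ℝ)) (b := u) 1
  rw [sub_zero, show (1 : ℝ) - u = ρ⁻¹ by rw [hu]; ring] at hsub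
  rw [← hsub]
  have hint : ∀ w : ℝ, (1 - (1 - w)) ^ i * (1 - ρ * (1 - w)) ^ j =
      (-ρ) ^ j * (w ^ i * (u - w) ^ j) := by
    intro w
    have h1 : 1 - ρ * (1 - w) = -ρ * (u - w) := by rw [hu]; field_simp; ring
    rw [sub_sub_cancel, h1, mul_pow]
    ring
  simp_rw [hint]
  rw [intervalIntegral.integral_const_mul, integral_pow_mul_sub_pow]
  have hρu : -ρ * u = 1 - ρ := by rw [hu]; field_simp; ring
  rw [show (1 - ρ) ^ j = (-ρ) ^ j * u ^ j by rw [← mul_pow, hρu]]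
  ring

/-! ## Two truncated series -/

/-- **The truncated double series**: for `ρ ≠ 0` and coefficient families `g` (inner, `i < Kin`),
`f` (outer, `j < Kout`),
`∫_{ρ⁻¹}^{1} (Σ_{i<Kin} g_i (1−x)^i)(Σ_{j<Kout} f_j (1−ρx)^j) dx
  = (1−ρ⁻¹) · Σ_{i<Kin} (Σ_{j<Kout} g_i f_j β(i,j) (1−ρ)^j) · (1−ρ⁻¹)^i`
— the shape `U · Σ_i rows_i · U^i`, `rows_i = Σ_j C_{ij} NS^j` of the Tier-2 panel model.
[cite: Jeffrey1995, §11.1.7.1 (Beta function) (p0143:L67–L76); ConnesConsani2021, §6.3 p. 24] -/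
theorem integral_sum_mul_sum_eq {ρ : ℝ} (hρ : ρ ≠ 0) (g f : ℕ → ℝ) (Kin Kout : ℕ) :
    ∫ x in ρ⁻¹..(1 : ℝ), (∑ i ∈ range Kin, g i * (1 - x) ^ i) *
        (∑ j ∈ range Kout, f j * (1 - ρ * x) ^ j) =
      (1 - ρ⁻¹) * ∑ i ∈ range Kin,
        (∑ j ∈ range Kout, g i * f j * ((i ! * j ! : ℝ) / (i + j + 1)!) * (1 - ρ) ^ j) *
          (1 - ρ⁻¹) ^ i := by
  have hexp : ∀ x : ℝ, (∑ i ∈ range Kin, g i * (1 - x) ^ i) *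
      (∑ j ∈ range Kout, f j * (1 - ρ * x) ^ j) =
      ∑ i ∈ range Kin, ∑ j ∈ range Kout, g i * f j * ((1 - x) ^ i * (1 - ρ * x) ^ j) := by
    intro x
    rw [Finset.sum_mul_sum]
    refine Finset.sum_congr rfl fun i _ ↦ Finset.sum_congr rfl fun j _ ↦ by ring
  simp_rw [hexp]
  rw [intervalIntegral.integral_finsetSum (fun i _ ↦ ?_)]
  · rw [Finset.mul_sum]
    refine Finset.sum_congr rfl fun i _ ↦ ?_
    rw [intervalIntegral.integral_finsetSum (fun j _ ↦ ?_)]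
    · rw [Finset.sum_mul, Finset.mul_sum]
      refine Finset.sum_congr rfl fun j _ ↦ ?_
      rw [intervalIntegral.integral_const_mul, integral_one_sub_pow_mul_one_sub_mul_pow hρ]
      ring
    · exact Continuous.intervalIntegrable (by fun_prop) _ _
  · refine (continuous_finsetSum _ fun j _ ↦ ?_).intervalIntegrable _ _
    fun_prop

/-! ## The mode sum: truncated bracket = the panel model polynomial -/

/-- **The truncated S₈ bracket equals the panel model** (piece (B1) of the Tier-2 read-back).  For
`ρ ≠ 0`, weights `t : ℕ → ℝ`, inner families `g n ·`, `f n ·` (used at indices `< Kin`) and outer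
families `f n ·` (indices `< Kout`) of `N` modes:
`Σ_{n<N} t_n·(ρ^{3/2}·(∫_{ρ⁻¹}^1 (Σ_{i<Kin} g_{n,i}(1−x)^i)(Σ_{j<Kout} f_{n,j}(1−ρx)^j)dx + Σ_{j<Kout} f_{n,j}(1−ρ)^j)
            − ρ^{−3/2}·Σ_{i<Kin} f_{n,i}(1−ρ⁻¹)^i)`
`= ρ^{3/2}·((1−ρ⁻¹)·Σ_{i<Kin}(Σ_{j<Kout} C_{ij}(1−ρ)^j)(1−ρ⁻¹)^i + Σ_{j<Kout} cFs_j(1−ρ)^j) − ρ^{−3/2}·Σ_{i<Kin} cFu_i(1−ρ⁻¹)^i`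
with `C_{ij} = Σ_{n<N} t_n g_{n,i} f_{n,j} β(i,j)`, `cFs_j = Σ_{n<N} t_n f_{n,j}`, `cFu_i = Σ_{n<N} t_n f_{n,i}`
— all eight modes contracted first, exactly as `ArchCertT2.combine`/`s8TM` compute it.
[cite: ConnesConsani2021, §5 eq. (99) p. 32 (the bracket, arXiv chunk p0020:L69–L78) and §6.3 p. 24 (the kernel); Jeffrey1995, §11.1.7.1 (p0143:L67–L76)] -/
theorem sum_trunc_eq_model {ρ : ℝ} (hρ : ρ ≠ 0) (t : ℕ → ℝ) (g f : ℕ → ℕ → ℝ)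
    (N Kin Kout : ℕ) :
    ∑ n ∈ range N, t n *
        (ρ ^ (3 / 2 : ℝ) *
            ((∫ x in ρ⁻¹..(1 : ℝ), (∑ i ∈ range Kin, g n i * (1 - x) ^ i) *
                (∑ j ∈ range Kout, f n j * (1 - ρ * x) ^ j)) +
              ∑ j ∈ range Kout, f n j * (1 - ρ) ^ j) -
          ρ ^ (-(3 / 2) : ℝ) * ∑ i ∈ range Kin, f n i * (1 - ρ⁻¹) ^ i) =
      ρ ^ (3 / 2 : ℝ) *
          ((1 - ρ⁻¹) * ∑ i ∈ range Kin,
              (∑ j ∈ range Kout,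
                  (∑ n ∈ range N, t n * g n i * f n j * ((i ! * j ! : ℝ) / (i + j + 1)!)) *
                    (1 - ρ) ^ j) * (1 - ρ⁻¹) ^ i +
            ∑ j ∈ range Kout, (∑ n ∈ range N, t n * f n j) * (1 - ρ) ^ j) -
        ρ ^ (-(3 / 2) : ℝ) * ∑ i ∈ range Kin, (∑ n ∈ range N, t n * f n i) * (1 - ρ⁻¹) ^ i := by
  simp_rw [integral_sum_mul_sum_eq hρ]
  -- pure finite-sum algebra: push `t n` inside and exchange the order of summation
  simp only [Finset.sum_mul, Finset.mul_sum, mul_sub, Finset.sum_sub_distrib, mul_add,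
    Finset.sum_add_distrib]
  congr 1
  · congr 1
    · rw [Finset.sum_comm]
      refine Finset.sum_congr rfl fun i _ ↦ ?_
      rw [Finset.sum_comm]
      refine Finset.sum_congr rfl fun j _ ↦ ?_
      refine Finset.sum_congr rfl fun n _ ↦ ?_
      ring
    · rw [Finset.sum_comm]
      refine Finset.sum_congr rfl fun j _ ↦ Finset.sum_congr rfl fun n _ ↦ ?_
      ring
  · rw [Finset.sum_comm]
    refine Finset.sum_congr rfl fun i _ ↦ Finset.sum_congr rfl fun n _ ↦ ?_
    ring

/-- **The same in the additive panel variable** `ρ = e^{v}`: `ρ^{3/2} = e^{(3/2)v}`,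
`ρ^{−3/2} = e^{−(3/2)v}`, `ρ⁻¹ = e^{−v}`, and the integral runs over `[e^{−v}, 1]` — the literal shape
of the functions the Taylor models `texpAt h 9 (3/2)`, `texpAt h 9 (−3/2)`, `1 − texpAt h 9 (−1)`,
`1 − texpAt h 9 1` of `ArchCertT2.s8TM` enclose.
[cite: ConnesConsani2021, §5 eq. (99) p. 32 and eq. (101) p. 33 (additive scale), §6.3 p. 24; Jeffrey1995, §11.1.7.1 (p0143:L67–L76)] -/
theorem sum_trunc_exp_eq_model (v : ℝ) (t : ℕ → ℝ) (g f : ℕ → ℕ → ℝ) (N Kin Kout : ℕ) :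
    ∑ n ∈ range N, t n *
        (Real.exp (3 / 2 * v) *
            ((∫ x in Real.exp (-v)..(1 : ℝ), (∑ i ∈ range Kin, g n i * (1 - x) ^ i) *
                (∑ j ∈ range Kout, f n j * (1 - Real.exp v * x) ^ j)) +
              ∑ j ∈ range Kout, f n j * (1 - Real.exp v) ^ j) -
          Real.exp (-(3 / 2 * v)) * ∑ i ∈ range Kin, f n i * (1 - Real.exp (-v)) ^ i) =
      Real.exp (3 / 2 * v) *
          ((1 - Real.exp (-v)) * ∑ i ∈ range Kin,
              (∑ j ∈ range Kout,
                  (∑ n ∈ range N, t n * g n i * f n j * ((i ! * j ! : ℝ) / (i + j + 1)!)) *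
                    (1 - Real.exp v) ^ j) * (1 - Real.exp (-v)) ^ i +
            ∑ j ∈ range Kout, (∑ n ∈ range N, t n * f n j) * (1 - Real.exp v) ^ j) -
        Real.exp (-(3 / 2 * v)) *
          ∑ i ∈ range Kin, (∑ n ∈ range N, t n * f n i) * (1 - Real.exp (-v)) ^ i := by
  have hρ : Real.exp v ≠ 0 := (Real.exp_pos v).ne'
  have key := sum_trunc_eq_model hρ t g f N Kin Kout
  have e1 : Real.exp v ^ (3 / 2 : ℝ) = Real.exp (3 / 2 * v) := by
    rw [← Real.exp_mul]; ring_nf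
  have e2 : Real.exp v ^ (-(3 / 2) : ℝ) = Real.exp (-(3 / 2 * v)) := by
    rw [← Real.exp_mul]; ring_nf
  have e3 : (Real.exp v)⁻¹ = Real.exp (-v) := (Real.exp_neg v).symm
  rw [e1, e2, e3] at key
  exact key

end S8Identity

end Literature.NumberTheory.ConnesConsani2021

end
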